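import Literature.Probability.RandomPlanarGeometry.SAWCountZdShapeCensus
import Literature.Probability.RandomPlanarGeometry.SAWCountZdSymbolPolynomiality
import Literature.Probability.RandomPlanarGeometry.SAWCountZdFifthCoefficientReduction
import HarnessLib

/-!
# (L1′) unconditional: the excess-four shape census in the kernel, `R₄ = (3X⁵ − 53X⁴ + 384X³ − 1474X² + 3150X − 3438)/96`, and the fifth `1/d`-coefficient of `c_n(ℤ^d)` for all `n ≥ 7`

Topic `Literature/Probability/RandomPlanarGeometry` (sequel of `SAWCountZdShapeCensus.lean` (the census engine, ★★★ `card_shapeClass_adjOf`),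
`SAWCountZdSymbolPolynomiality.lean` (a-p1 g22: `#T_j(n) = 2^n R_j(n)`, `R_j = symbolPoly j` a finite sum over the shape classes,
`card_canonical_bad_eq_pow_mul_eval`) and `SAWCountZdFifthCoefficientReduction.lean` (a-p1 g22: (L1′) for all `n ≥ 7` ⟸ the ONE count
`#T_4(l+4) = 2^l b₄(l+4)`, `exists_polynomial_count_topFive_of_card_canonical`)).

PRINTED CONTEXT (locators only; nothing is quoted digit-for-digit). Madras–Slade (1993) §1.1 eq. (1.1.8) p. 5 (the `1/d` expansion of `μ`
through `(2d)^{-4}`, after Fisher–Sykes / Fisher–Gaunt, "although there is no rigorous control of their error term"), Definition 1.2.4, §1.2 p. 10;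
Clisby–Liang–Slade (2007) §1.3 eq. (1) (the expansion through `(2d)^{-6}`), §3.3 eqs. (29)/(31). NOT IN PRINT as far as the lane's desks could
locate: the coefficient laws of `c_n(ℤ^d)` IN `n` below.

THIS FILE (on the kernel cells ★★ `card_shapeClass_four` of `SAWCountZdShapeCensus.lean`: `#shapeClass_4(u, A_c) = 2^(u−4) · shN u c`). (1) CLASS CODES: `codeOf`/`adjOf` are inverse on valid adjacency vectors (`adjOf_codeOf`,
`codeOf_adjOf`), ★ `sum_adjValid_eq_sum_range`, `breaks_adjOf` (`breaksN`). (2) THE ASSEMBLY: the grouped counts `shM u b = Σ_{c : breaks = b}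
#shapeClass_4(u, A_c)` are ★ `shM_eq_lit`: `M(6,1..3) = (96, 256, 192)`, `M(7,1..4) = (792, 2272, 2256, 896)`, `M(8,1..5) = (1296, 3408, 5040,
3456, 960)` (all other `M(u,b) = 0`) — FINDING-ZD-SYMBOL-POLYNOMIALITY §3's census `2^{u−4} N₄(u,c)`, now a kernel fact; ★★ `symbolPoly_four_eq_sum`
(`R₄ = Σ_u Σ_b C(M(u,b)·2^{−u}/b!)·(X)_b ∘ (X + 1 − u)`) and ★★★ `symbolPoly_four`: `R₄(X) = (3X⁵ − 53X⁴ + 384X³ − 1474X² + 3150X − 3438)/96`.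
(3) THE LAW: ★★★ `card_canonical_bad_four` (`#T_4(l+4) = 2^l b₄(l+4)` for every `l ≥ 3` — the hypothesis `hT` of the reduction file, DISCHARGED),
★★★ `exists_polynomial_count_topFive` and ★★★ `exists_polynomial_count_fifth` — (L1′) UNCONDITIONAL: for every `n ≥ 7` the counting polynomial
`P_n(d) = c_n(ℤ^d)` has `24·[d^{n−4}] P_n = 2^{n−4}(n⁴ − 22n³ + 215n² − 1298n + 4272)` (with the four higher coefficients `[d^n] = 2^n`,
`[d^{n−1}] = −(n−1)2^{n−1}`, `[d^{n−2}] = 2^{n−3}(n² − 5n + 8)`, `48·[d^{n−3}] = −2^n(n³ − 12n² + 59n − 138)`). The definitions `codeOf`, `breaksN`, `shM`, `shMlit`, `symTerm` are this file's tool notions (not notions in print); no number is taken from print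
(the grouped counts are kernel facts read off the census tables of `SAWCountZdShapeCensus.lean`).
[cite: MadrasSlade1993, §1.1 eq. (1.1.8) p. 5; Definition 1.2.4; §1.2 (p. 10)] [cite: ClisbyLiangSlade2007, §1.3 eq. (1); §3.3 eqs. (29)/(31)]

Provenance: lane «pcv-sawmu», a-p1 g23 (2026-08-27).
-/

open Finset
open scoped BigOperators
open Literature.Probability.LatticeModels
open Literature.Probability.RandomPlanarGeometry.SAW
open Literature.Probability.Percolation

namespace Literature.Probability.RandomPlanarGeometry.SAW.Zd

namespace WordTypes

/-! ### Adjacency vectors as class codes -/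

section codes

/-- `adjOf u c` is a valid adjacency vector (its last entry is a break). [cite: MadrasSlade1993, Definition 1.2.4; lane plumbing] -/
theorem adjValid_adjOf (u c : ℕ) : AdjValid (adjOf u c) := by
  intro h; unfold adjOf
  have : ¬ (u - 1 + 1 < u) := by omega
  simp [this]

/-- The class code of an adjacency vector: its first `u − 1` entries as bits. [cite: MadrasSlade1993, Definition 1.2.4; lane tool notion] -/
def codeOf {u : ℕ} (A : Fin u → Bool) : ℕ := Nat.ofBits fun k : Fin (u - 1) => A ⟨k.val, by omega⟩

/-- The code is below `2^(u−1)`. [cite: MadrasSlade1993, Definition 1.2.4; lane plumbing] -/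
theorem codeOf_lt {u : ℕ} (A : Fin u → Bool) : codeOf A < 2 ^ (u - 1) := Nat.ofBits_lt_two_pow _

/-- Decoding the code of a valid adjacency vector gives it back. [cite: MadrasSlade1993, Definition 1.2.4; lane plumbing] -/
theorem adjOf_codeOf {u : ℕ} (A : Fin u → Bool) (hA : AdjValid A) : adjOf u (codeOf A) = A := by
  funext k
  unfold adjOf codeOf
  rw [Nat.testBit_ofBits]
  by_cases hk : k.val + 1 < u
  · rw [dif_pos (by omega)]; simp [hk]
  · rw [dif_neg (by omega)]
    have hk' : k = ⟨u - 1, by omega⟩ := Fin.ext (by simp; omega)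
    rw [hk', hA (by omega)]; simp

/-- Coding a decoded class code gives it back. [cite: MadrasSlade1993, Definition 1.2.4; lane plumbing] -/
theorem codeOf_adjOf {u : ℕ} (c : ℕ) (hc : c < 2 ^ (u - 1)) : codeOf (adjOf u c) = c := by
  unfold codeOf adjOf
  apply Nat.eq_of_testBit_eq
  intro i
  rw [Nat.testBit_ofBits]
  by_cases hi : i < u - 1
  · rw [dif_pos hi]; simp; omega
  · rw [dif_neg hi]
    symm
    exact Nat.testBit_lt_two_pow (lt_of_lt_of_le hc (Nat.pow_le_pow_right (by norm_num) (by omega)))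

open Classical in
/-- ★ SUMS OVER VALID ADJACENCY VECTORS are sums over class codes. [cite: MadrasSlade1993, Definition 1.2.4; lane lemma] -/
theorem sum_adjValid_eq_sum_range {M : Type*} [AddCommMonoid M] (u : ℕ) (F : (Fin u → Bool) → M) :
    ∑ A : Fin u → Bool, (if AdjValid A then F A else 0) = ∑ c ∈ Finset.range (2 ^ (u - 1)), F (adjOf u c) := by
  rw [← Finset.sum_filter]
  refine Finset.sum_nbij' codeOf (adjOf u) (fun A _ => Finset.mem_range.2 (codeOf_lt A))
    (fun c _ => Finset.mem_filter.2 ⟨Finset.mem_univ _, adjValid_adjOf u c⟩)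
    (fun A hA => adjOf_codeOf A (Finset.mem_filter.1 hA).2) (fun c hc => codeOf_adjOf c (Finset.mem_range.1 hc)) ?_
  intro A hA
  rw [adjOf_codeOf A (Finset.mem_filter.1 hA).2]

/-- The number of breaks of a class code, computably. [cite: MadrasSlade1993, Definition 1.2.4; lane tool notion] -/
def breaksN (u c : ℕ) : ℕ := ((List.range u).filter fun k => !(decide (k + 1 < u) && c.testBit k)).length

/-- ★ `breaks (adjOf u c) = breaksN u c`. [cite: MadrasSlade1993, Definition 1.2.4; lane lemma] -/
theorem breaks_adjOf (u c : ℕ) : breaks (adjOf u c) = breaksN u c := by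
  unfold breaks breaksN adjOf
  rw [Finset.card_filter, ← List.countP_eq_length_filter, countP_eq_sum_map_ite, sum_map_range,
    ← Fin.sum_univ_eq_sum_range (fun k => if (!(decide (k + 1 < u) && c.testBit k)) = true then 1 else 0) u]
  refine Finset.sum_congr rfl fun k _ => ?_
  simp only [Bool.not_eq_true', Bool.eq_false_iff, ne_eq]

/-- `breaksN u c ≤ u`. [cite: MadrasSlade1993, Definition 1.2.4; lane plumbing] -/
theorem breaksN_le (u c : ℕ) : breaksN u c ≤ u := by
  unfold breaksN
  exact (List.length_filter_le _ _).trans (by simp)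

end codes

/-! ### The symbol polynomial of excess four from the census -/

section assembly

open Polynomial

/-- The grouped shape counts `M(u, b) = Σ_{c : breaks = b} #shapeClass_4(u, A_c)` from the tables (`4 ≤ u ≤ 8`; else `0`).
[cite: MadrasSlade1993, Definition 1.2.4; lane census] -/
def shM (u b : ℕ) : ℕ := ((List.range (2 ^ (u - 1))).map fun c => if breaksN u c = b then 2 ^ (u - 4) * shN u c else 0).sum

/-- The twelve non-zero grouped counts (and the zeros), all at once. [cite: MadrasSlade1993, Definition 1.2.4; lane census] -/
def shMlit : List (List ℕ) :=
  [[0], [0, 0], [0, 0, 0], [0, 0, 0, 0], [0, 0, 0, 0, 0], [0, 0, 0, 0, 0, 0], [0, 96, 256, 192, 0, 0, 0],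
    [0, 792, 2272, 2256, 896, 0, 0, 0], [0, 1296, 3408, 5040, 3456, 960, 0, 0, 0]]

/-- ★ THE GROUPED COUNTS: `M(6,·) = (96, 256, 192)`, `M(7,·) = (792, 2272, 2256, 896)`, `M(8,·) = (1296, 3408, 5040, 3456, 960)` at
`b = 1, 2, …` (kernel evaluation of the tables). [cite: MadrasSlade1993, Definition 1.2.4; lane census] -/
theorem shM_eq_lit : ∀ u < 9, ∀ b < u + 1, shM u b = (shMlit.getD u []).getD b 0 := by decide +kernel

/-- The polynomial basis element `C(M · 2^{−u} / b!) · (X)_b ∘ (X + 1 − u)`. [cite: MadrasSlade1993, §1.1 eq. (1.1.8) p. 5; lane plumbing] -/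
noncomputable def symTerm (u b : ℕ) (M : ℚ) : Polynomial ℚ :=
  Polynomial.C (M * (1 / 2) ^ u / (b.factorial : ℚ)) * (descPochhammer ℚ b).comp (Polynomial.X + Polynomial.C ((1 : ℚ) - u))

/-- `symTerm` is additive in the count. [cite: MadrasSlade1993, §1.1 eq. (1.1.8) p. 5; lane plumbing] -/
theorem symTerm_add (u b : ℕ) (M M' : ℚ) : symTerm u b (M + M') = symTerm u b M + symTerm u b M' := by
  unfold symTerm; rw [← add_mul, ← Polynomial.C_add]; congr 2; ring

/-- `symTerm` of a zero count vanishes. [cite: MadrasSlade1993, §1.1 eq. (1.1.8) p. 5; lane plumbing] -/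
theorem symTerm_zero (u b : ℕ) : symTerm u b 0 = 0 := by unfold symTerm; simp

open Classical in
/-- ★★ THE SYMBOL POLYNOMIAL OF EXCESS FOUR FROM THE CENSUS: `R₄ = Σ_{u ≤ 8} Σ_{b ≤ u} C(M(u,b) · 2^{−u}/b!) · (X)_b ∘ (X + 1 − u)`.
[cite: MadrasSlade1993, §1.1 eq. (1.1.8) p. 5; Definition 1.2.4; lane theorem] -/
theorem symbolPoly_four_eq_sum :
    symbolPoly 4 = ∑ u ∈ Finset.range 9, ∑ b ∈ Finset.range (u + 1), symTerm u b (shM u b : ℚ) := by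
  unfold symbolPoly
  refine Finset.sum_congr rfl fun u hu => ?_
  have hu9 : u < 9 := Finset.mem_range.1 hu
  rw [sum_adjValid_eq_sum_range u]
  -- every class term is `symTerm u (breaksN u c) (count)`; regroup by the number of breaks
  have hcount : ∀ c ∈ Finset.range (2 ^ (u - 1)), (shapeClass 4 u (adjOf u c)).card = 2 ^ (u - 4) * shN u c := by
    intro c hc
    by_cases h4 : u < 4
    · rw [shapeClass_four_eq_empty h4]
      have : shN u c = 0 := by
        unfold shN shTab
        rw [if_neg (by omega), if_neg (by omega), if_neg (by omega), if_neg (by omega), if_neg (by omega)]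
        simp
      simp [this]
    · exact card_shapeClass_four u c (by omega) (by omega) (Finset.mem_range.1 hc)
  have hterm : ∀ c ∈ Finset.range (2 ^ (u - 1)),
      Polynomial.C ((((shapeClass 4 u (adjOf u c)).card : ℚ) * (1 / 2) ^ u / ((breaks (adjOf u c)).factorial : ℚ))) *
        (descPochhammer ℚ (breaks (adjOf u c))).comp (Polynomial.X + Polynomial.C ((1 : ℚ) - u)) =
      symTerm u (breaksN u c) ((2 ^ (u - 4) * shN u c : ℕ) : ℚ) := by
    intro c hc
    rw [breaks_adjOf, hcount c hc]
    rfl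
  rw [Finset.sum_congr rfl hterm,
    ← Finset.sum_fiberwise_of_maps_to (s := Finset.range (2 ^ (u - 1))) (t := Finset.range (u + 1)) (g := breaksN u)
      (fun c _ => Finset.mem_range.2 (Nat.lt_succ_of_le (breaksN_le u c)))]
  refine Finset.sum_congr rfl fun b _ => ?_
  have hfib : ∀ c ∈ (Finset.range (2 ^ (u - 1))).filter (fun c => breaksN u c = b),
      symTerm u (breaksN u c) ((2 ^ (u - 4) * shN u c : ℕ) : ℚ) = symTerm u b ((2 ^ (u - 4) * shN u c : ℕ) : ℚ) := by
    intro c hc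
    rw [(Finset.mem_filter.1 hc).2]
  rw [Finset.sum_congr rfl hfib]
  have hlin : ∀ (s : Finset ℕ) (f : ℕ → ℕ), ∑ c ∈ s, symTerm u b (f c : ℚ) = symTerm u b ((∑ c ∈ s, f c : ℕ) : ℚ) := by
    intro s f
    induction s using Finset.induction_on with
    | empty => simp [symTerm_zero]
    | insert a s ha ih => rw [Finset.sum_insert ha, Finset.sum_insert ha, ih, Nat.cast_add, symTerm_add, add_comm]
  rw [hlin, Finset.sum_filter]
  unfold shM
  rw [sum_map_range]

/-- ★★★ THE SYMBOL POLYNOMIAL OF EXCESS FOUR: `R₄(X) = (3X⁵ − 53X⁴ + 384X³ − 1474X² + 3150X − 3438)/96` — the finite shape census makes the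
fifth `1/d`-coefficient count explicit. [cite: MadrasSlade1993, §1.1 eq. (1.1.8) p. 5; Definition 1.2.4; lane theorem] -/
theorem symbolPoly_four :
    symbolPoly 4 = Polynomial.C ((1 : ℚ) / 96) *
      (3 * Polynomial.X ^ 5 - 53 * Polynomial.X ^ 4 + 384 * Polynomial.X ^ 3 - 1474 * Polynomial.X ^ 2 + 3150 * Polynomial.X - 3438) := by
  rw [symbolPoly_four_eq_sum]
  have hM : ∀ u ∈ Finset.range 9, ∀ b ∈ Finset.range (u + 1), symTerm u b (shM u b : ℚ) = symTerm u b ((shMlit.getD u []).getD b 0 : ℕ) := by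
    intro u hu b hb
    rw [shM_eq_lit u (Finset.mem_range.1 hu) b (Finset.mem_range.1 hb)]
  rw [Finset.sum_congr rfl fun u hu => Finset.sum_congr rfl fun b hb => hM u hu b hb]
  apply Polynomial.funext
  intro x
  simp only [Finset.sum_range_succ, Finset.sum_range_zero, zero_add, shMlit, List.getD_cons_succ, List.getD_cons_zero,
    symTerm, Polynomial.eval_add, Polynomial.eval_mul, Polynomial.eval_C,
    Polynomial.eval_comp, Polynomial.eval_X, Polynomial.eval_sub, Polynomial.eval_pow, Polynomial.eval_natCast,
    descPochhammer_succ_right, descPochhammer_zero, Polynomial.eval_one, Nat.factorial, Nat.cast_zero, Nat.cast_ofNat]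
  norm_num
  ring

end assembly

/-! ### (L1′) unconditional: the fifth `1/d`-coefficient of `c_n(ℤ^d)` for all `n ≥ 7` -/

section fifth

open Classical in
/-- ★★★ THE CENSUS COUNT `hT`: for every `l ≥ 3`, the canonical reversal-free words of length `l + 4` with `l` axes and a repeat number
`2^l · b₄(l + 4)`, `b₄(X) = (3X⁵ − 53X⁴ + 384X³ − 1474X² + 3150X − 3438)/6`. [cite: MadrasSlade1993, §1.1 eq. (1.1.8) p. 5; Definition 1.2.4; lane theorem] -/
theorem card_canonical_bad_four (l : ℕ) (hl : 3 ≤ l) :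
    (((Finset.univ.filter fun τ : Word (l + 4) (l + 4) => canon τ = τ ∧ numAxes τ = l ∧
        (∀ p : Fin (l + 4), ∀ hp : p.val + 1 < l + 4, τ ⟨p.val + 1, hp⟩ ≠ ((τ p).1, !(τ p).2)) ∧
        (∃ i ≤ l + 4, ∃ j ≤ l + 4, i < j ∧ wordPos τ i = wordPos τ j)).card : ℕ) : ℚ) =
      2 ^ l * ((3 * ((l : ℚ) + 4) ^ 5 - 53 * ((l : ℚ) + 4) ^ 4 + 384 * ((l : ℚ) + 4) ^ 3 - 1474 * ((l : ℚ) + 4) ^ 2 +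
        3150 * ((l : ℚ) + 4) - 3438) / 6) := by
  rw [card_canonical_bad_eq_pow_mul_eval 4 l (by omega), symbolPoly_four]
  simp only [Polynomial.eval_mul, Polynomial.eval_C, Polynomial.eval_add, Polynomial.eval_sub, Polynomial.eval_pow,
    Polynomial.eval_X, Polynomial.eval_ofNat]
  push_cast
  ring

/-- ★★★ (L1′) UNCONDITIONAL — THE FIFTH `1/d`-COEFFICIENT OF `c_n(ℤ^d)`: for every `l ≥ 3` (`n = l + 4 ≥ 7`) the counting polynomial of the
`n`-step self-avoiding walks of `ℤ^d` has `24·[d^{n−4}] c_n(ℤ^d) = 2^{n−4}(n⁴ − 22n³ + 215n² − 1298n + 4272)` (with the four higher coefficients),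
by the excess-four shape census in the kernel + the reduction `SAWCountZdFifthCoefficientReduction`.
[cite: MadrasSlade1993, §1.1 eq. (1.1.8) p. 5; §1.2 p. 10] [cite: ClisbyLiangSlade2007, §1.3 eq. (1); lane theorem] -/
theorem exists_polynomial_count_topFive (l : ℕ) (hl : 3 ≤ l) :
    ∃ P : Polynomial ℚ, P.natDegree ≤ l + 4 ∧ P.coeff (l + 4) = (2 : ℚ) ^ (l + 4) ∧
      P.coeff (l + 3) = -(((l + 4 : ℕ) : ℚ) - 1) * 2 ^ (l + 3) ∧
      P.coeff (l + 2) = 2 ^ (l + 1) * (((l + 4 : ℕ) : ℚ) ^ 2 - 5 * ((l + 4 : ℕ) : ℚ) + 8) ∧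
      48 * P.coeff (l + 1) = -(2 : ℚ) ^ (l + 4) * (((l + 4 : ℕ) : ℚ) ^ 3 - 12 * ((l + 4 : ℕ) : ℚ) ^ 2 + 59 * ((l + 4 : ℕ) : ℚ) - 138) ∧
      24 * P.coeff l = (2 : ℚ) ^ l * (((l + 4 : ℕ) : ℚ) ^ 4 - 22 * ((l + 4 : ℕ) : ℚ) ^ 3 + 215 * ((l + 4 : ℕ) : ℚ) ^ 2 - 1298 * ((l + 4 : ℕ) : ℚ) + 4272) ∧
      ∀ d : ℕ, (count d (l + 4) : ℚ) = P.eval (d : ℚ) :=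
  exists_polynomial_count_topFive_of_card_canonical l hl (card_canonical_bad_four l hl)

/-- ★★★ (L1′) IN `n`-FORM: for every `n ≥ 7` the `n`-step self-avoiding walks of `ℤ^d` are counted by a polynomial `P_n(d)` of degree `≤ n`
with `[d^n] = 2^n`, `[d^{n−1}] = −(n−1)2^{n−1}`, `[d^{n−2}] = 2^{n−3}(n² − 5n + 8)`, `48·[d^{n−3}] = −2^n(n³ − 12n² + 59n − 138)` and the FIFTH
coefficient `24·[d^{n−4}] P_n = 2^{n−4}(n⁴ − 22n³ + 215n² − 1298n + 4272)`. [cite: MadrasSlade1993, §1.1 eq. (1.1.8) p. 5; §1.2 p. 10]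
[cite: ClisbyLiangSlade2007, §1.3 eq. (1); lane theorem] -/
theorem exists_polynomial_count_fifth (n : ℕ) (hn : 7 ≤ n) :
    ∃ P : Polynomial ℚ, P.natDegree ≤ n ∧ P.coeff n = (2 : ℚ) ^ n ∧
      P.coeff (n - 1) = -((n : ℚ) - 1) * 2 ^ (n - 1) ∧
      P.coeff (n - 2) = 2 ^ (n - 3) * ((n : ℚ) ^ 2 - 5 * (n : ℚ) + 8) ∧
      48 * P.coeff (n - 3) = -(2 : ℚ) ^ n * ((n : ℚ) ^ 3 - 12 * (n : ℚ) ^ 2 + 59 * (n : ℚ) - 138) ∧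
      24 * P.coeff (n - 4) = (2 : ℚ) ^ (n - 4) * ((n : ℚ) ^ 4 - 22 * (n : ℚ) ^ 3 + 215 * (n : ℚ) ^ 2 - 1298 * (n : ℚ) + 4272) ∧
      ∀ d : ℕ, (count d n : ℚ) = P.eval (d : ℚ) := by
  obtain ⟨l, rfl⟩ : ∃ l, n = l + 4 := ⟨n - 4, by omega⟩
  obtain ⟨P, hdeg, h0, h1, h2, h3, h4, hev⟩ := exists_polynomial_count_topFive l (by omega)
  refine ⟨P, hdeg, h0, ?_, ?_, ?_, ?_, hev⟩
  · rw [show l + 4 - 1 = l + 3 by omega, h1]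
  · rw [show l + 4 - 2 = l + 2 by omega, show l + 4 - 3 = l + 1 by omega, h2]
  · rw [show l + 4 - 3 = l + 1 by omega, h3]
  · rw [show l + 4 - 4 = l by omega, h4]

end fifth

end WordTypes

end Literature.Probability.RandomPlanarGeometry.SAW.Zd
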